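import Summits.QuantumFields.YangMills.Theorems.BalabanUVNodesN15KingModelBoxTimeSlices
import Summits.QuantumFields.YangMills.Theorems.BalabanUVNodesN15KingModelTorusHalfSpaces
import HarnessLib

/-!
# BalabanUVNodes ∕ N15 — THE KING-MODEL RUNG (PART Ν-d, v1.1 doc-only erratum): THE NEUMANN FORM BY DOUBLING — `⟨f∘fold, B_{T(2n)}(f∘fold)⟩ = 2^{d+1}⟨f,(c(−Δ_free)+m²)f⟩`;
# THE FREE-BOUNDARY OPERATOR IS SYMMETRIC, COERCIVE (`≥ m²`) AND POSITIVE DEFINITE; KING's FREE FIELD ON THE BOX WITH FREE BOUNDARY CONDITIONS AS A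
# GAUSSIAN LAW WITH TWO-POINT FUNCTION THE IMAGE SUM
# (Track A, DAG node N15 = NE2; FAN-OUT v1.1 §N15 s3 «KING-MODEL RUNG» — «torus-vs-box twin»; count-neutral)

HONEST FRAMING.  Count-neutral (cell `pub-ymgap`, seat `pub-ymgap-dag-n15-e` g39; `--supports stmt-QuantumFields-27366 --as helper` = K3⁸).
TEMPLATE LITERATURE: C. King, Commun. Math. Phys. **102** (1986) 649–677 [King1986] §4 p.670 (multiple reflection representations of the Ω-propagators,
after [Ba 4] = [Balaban1983RegularityDecay] (2.42)), (2.6) p.652 (the free Gaussian measure), (2.13) p.653, (4.4) p.670 (symbol).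

ATTRIBUTION ∕ ERRATUM (v1.1, doc-only; ref-I READ-925 LOCATED-1 (quote), adopted).  King's p.670 text (§4, l.8–13) is: «By using multiple reflection representations,
the propagators G^η_k and G^η_k(Ω) can be written in terms of the operator defined by (2.13) with free boundary conditions (and A = 0, of course), as long
as Ω is a rectangular parallelepiped which is a union of blocks of L^k sites. Such representations are given explicitly in [Ba 4], so it is sufficient to
prove Propositions 3.8 and 3.9 for the operator with free boundary conditions» — i.e. King, following [Ba 4] = [Balaban1983RegularityDecay] (2.42) p.584
(«We represent G_j(□) with the help of the propagator G_j with free boundary conditions on ξZ^d using the multiple reflection method»), writes the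
Ω-propagators as image sums of the operator on the INFINITE lattice and proves his estimates for that operator.  Two sentences typeset as King quotations
in v1.0 of parts Ν-c ∕ Ν-d ∕ Ν-f — «…prove estimates on a lattice with periodic boundary conditions, and then carry over the results to Ω» and «All the
operators we use on Ω can be defined in this way, by restricting the corresponding operators on the torus to symmetric functions» — are NOT in
[King1986]: they were this author's paraphrases of the method, wrongly set in guillemets, and are WITHDRAWN as quotations (likewise v1.0's phrase «every
estimate is proved on the torus and transported to Ω» in parts Ν-a∕a′∕b: King proves the estimates for the free-boundary operator on ηℤ^d; the torus is
this lineage's model of it).  What PART Ν formalises is the PERIODIZED, FINITE form of [Ba 4]'s image series — the `2^{d+1}` images in the TORUS of doubled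
periods ([Ba 4]'s image group `Bool^{d+1} × ℤ^{d+1}` modulo the period lattice) — a device of these files (the classical method of images), chosen because
the tree carries King's operators on tori (`King1986.Torus.lapF`, `effLaplacian`); the box boundary condition so represented is the Neumann («free»)
condition of [Ba 4]'s `G_j(□)` ∕ [Balaban1984PropagatorsII] (2.37).  Every theorem of v1.0 is unchanged; only prose and locators are corrected.  Over parts
Ν-a∕Ν-a′∕Ν-b (`boxOp`, `kingBoxGreen`, `boxOp_inv_apply`, the tiling `tilingEquiv`, `foldBox`) and part Ϝ-u's density-defined Gaussian law `gaussLaw`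
(`…GaussianLawIdentification`: `gaussLaw A = N(0, A⁻¹)` for coercive symmetric `A`) THIS FILE proves: (§1) the EVEN EXTENSION `F = f∘foldBox` of a box
function to the doubled torus is blind to every multi-reflection, and `B = c(−Δ)+m²` maps it to a `σ`-even function whose restriction to the box is
`(c(−Δ_free)+m²)f` (part Ν-a's reflection principle); (§2) ★★ **`dotProduct_lapF_evenExt`** — the method-of-images reading «operator on Ω = reflection-commuting operator restricted to
reflection-symmetric functions» ([Ba 4] (2.42)) AS AN IDENTITY OF QUADRATIC FORMS:
`⟨F, B_{T(2n)}F⟩ = 2^{d+1}·⟨f, (c(−Δ_free)+m²)f⟩` (each reflected copy of the box carries one copy of the Neumann form; bonds across faces join equal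
values), whence ★★ `boxOp_coercive` (`⟨f,(c(−Δ_free)+m²)f⟩ ≥ m²⟨f,f⟩`, from `lapF_coercive` on the doubled torus), ★ `boxOp_transpose` (symmetric: its
inverse `G^{Ω}` is), ★★ `boxOp_posDef`; (§3) KING's FREE FIELD ON `Ω` WITH FREE BOUNDARY CONDITIONS, `ρ_Ω(φ)dφ ∝ exp(−½⟨φ,(c(−Δ_free)+m²)φ⟩)dφ`
(`gaussLaw (boxOp n c m²)`): a probability measure, ★★★ **`cov_eval_boxLaw`** (`Cov(φ(s),φ(t)) = Σ_S B⁻¹_{T(2n)}(dblBox s, σ_S dblBox t)` — the two-point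
function IS the image sum), `boxLaw_eq_gaussianFieldOfKernel` (`= N(0, G^{Ω})`), strict positivity of the two-point function, and its timeslices
`Σ_{s′_κ=a}Cov(φ(s′),φ(t)) = c⁻¹·pathGreen (n κ) (m²∕c) a t_κ` (part Ν-b).
NOT Bałaban's covariant objects; NOT a node discharge (N15 is booked through n15-a's knit, untouched); nothing continuum-YM ∕ `ℝ⁴` ∕ OS axioms ∕ Clay.
0 `sorry`, 0 `def`.  PRIOR TREE ART as named in part Ν-a; the free Gaussian law machinery is part Ϝ-u's (this lineage).

WHAT THIS FILE PROVES (kernel).  §1 `torReflS_torReflS_eq_symmDiff` (`σ_Sσ_T = σ_{S△T}`), ★ `foldBox_torReflS`, `torRefl_eq_torReflS_singleton`, `foldBox_torRefl`,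
`foldBox_dblBox`, ★ `lapF_mulVec_evenExt_torReflS`, ★ `lapF_mulVec_evenExt_dblBox`.  §2 ★★ **`dotProduct_lapF_evenExt`**, `dotProduct_evenExt_self`, ★★ `boxOp_coercive`,
★ `boxOp_transpose`, `boxOp_comm`, ★★ `boxOp_posDef`.  §3 `isProbabilityMeasure_boxLaw`, ★★★ **`cov_eval_boxLaw`**, `boxLaw_eq_gaussianFieldOfKernel`,
★ `cov_eval_boxLaw_pos`, ★ `timeSlice_cov_boxLaw`.

HONEST SCOPE.  `c ≥ 0`, `m² > 0` (`c > 0` for strict positivity and the timeslice closed form); any `d`, any sides `n_μ ≥ 1`.  King's `A = 0` scalar model;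
N15 untouched; counts unmoved.  Locators: [King1986] §4 p.670, (2.6) p.652, (2.13) p.653; [MontvayMunster1994] §2.2.1 (2.74)–(2.76).
-/

noncomputable section

open scoped BigOperators symmDiff
open Finset Matrix MeasureTheory ProbabilityTheory

namespace Summit.QuantumFields.YangMills.BalabanUVNodes.N15KingModelRung.TorusSpectral

open Literature.MathematicalPhysics.QuantumFieldTheory (IsPosSemidefKernel gaussianFieldOfKernel)
open Literature.MathematicalPhysics.QuantumFieldTheory.Balaban1983to89.B5Prop11Plancherel (Tor unitVec)
open Literature.MathematicalPhysics.QuantumFieldTheory.Balaban1983to89.QGQInverse (Coercive)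
open Literature.MathematicalPhysics.QuantumFieldTheory.King1986.Torus
open Literature.Probability.LatticeModels (mulVec_comp_equiv_eq)
open Summit.QuantumFields.YangMills.BalabanUVNodes.N15.TwoGrid (torRefl torRefl_torRefl torRefl_apply_same torRefl_apply_ne)
open Summit.QuantumFields.YangMills.BalabanUVNodes.N15.KingModel.SrcDiv (lapF_torRefl)
open Summit.QuantumFields.YangMills.BalabanUVNodes.N15KingModelRung.ProperTime (lapF_inv_nonneg lapF_inv_pos isUnit_lapF)
open Summit.QuantumFields.YangMills.BalabanUVNodes.N15KingModelRung.FreeField (gaussLaw gaussLaw_eq_gaussianFieldOfKernel isProbabilityMeasure_gaussLaw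
  covariance_eval_gaussLaw)

variable {d : ℕ}

/-! ## §1 The even extension `f ∘ foldBox` to the doubled torus and its invariances -/

section EvenExtension

variable (n : Fin (d + 1) → ℕ) [hn : ∀ μ, NeZero (n μ)]

omit hn in
/-- `σ_S ∘ σ_T = σ_{S △ T}` (the multi-reflections form the group `𝒫({0,…,d}) ≅ (ℤ∕2)^{d+1}`). [folklore] -/
theorem torReflS_torReflS_eq_symmDiff (K : Fin (d + 1) → ℕ) (S T : Finset (Fin (d + 1))) (z : Tor K) :
    torReflS K S (torReflS K T z) = torReflS K (S ∆ T) z := by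
  funext μ
  by_cases hS : μ ∈ S <;> by_cases hT : μ ∈ T <;> simp [torReflS, Finset.mem_symmDiff, hS, hT]

/-- ★ Folding is blind to every multi-reflection: `foldBox (σ_S w) = foldBox w`. [cite: King1986, §4 p.670] -/
theorem foldBox_torReflS (S : Finset (Fin (d + 1))) (w : Tor (dblPer n)) : foldBox n (torReflS (dblPer n) S w) = foldBox n w := by
  obtain ⟨⟨T, s⟩, rfl⟩ := (tilingEquiv n).surjective w
  show foldBox n (torReflS (dblPer n) S (torReflS (dblPer n) T (dblBox n s))) = foldBox n (torReflS (dblPer n) T (dblBox n s))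
  rw [torReflS_torReflS_eq_symmDiff, foldBox_torReflS_dblBox, foldBox_torReflS_dblBox]

omit hn in
/-- `σ_κ = σ_{{κ}}`. [folklore] -/
theorem torRefl_eq_torReflS_singleton (K : Fin (d + 1) → ℕ) (κ : Fin (d + 1)) (w : Tor K) : torRefl K κ w = torReflS K {κ} w := by
  funext μ
  by_cases h : μ = κ
  · subst h; simp [torReflS]
  · rw [torRefl_apply_ne _ h]; simp [torReflS, h]

/-- Folding is blind to every block-face reflection: `foldBox (σ_κ w) = foldBox w`. [cite: King1986, §4 p.670] -/
theorem foldBox_torRefl (κ : Fin (d + 1)) (w : Tor (dblPer n)) : foldBox n (torRefl (dblPer n) κ w) = foldBox n w := by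
  rw [torRefl_eq_torReflS_singleton, foldBox_torReflS]

/-- `foldBox (dblBox s) = s`. [folklore] -/
theorem foldBox_dblBox (s : KingBox n) : foldBox n (dblBox n s) = s := by
  simpa using foldBox_torReflS_dblBox n ∅ s

/-- ★ `B = c(−Δ)+m²` applied to the even extension is even: `(B(f∘foldBox))(σ_S w) = (B(f∘foldBox))(w)` (`B` commutes with every `σ_κ`). [cite: King1986, (2.13) p.653, §4 p.670] -/
theorem lapF_mulVec_evenExt_torReflS (c m2 : ℝ) (f : KingBox n → ℝ) (S : Finset (Fin (d + 1))) (w : Tor (dblPer n)) :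
    (lapF (dblPer n) c m2 *ᵥ fun w' => f (foldBox n w')) (torReflS (dblPer n) S w)
      = (lapF (dblPer n) c m2 *ᵥ fun w' => f (foldBox n w')) w := by
  induction S using Finset.induction_on generalizing w with
  | empty => rw [torReflS_empty]
  | insert κ S hκ ih =>
    rw [torReflS_insert (dblPer n) hκ]
    have hθ := mulVec_comp_equiv_eq (A := lapF (dblPer n) c m2) (θ := Function.Involutive.toPerm (torRefl (dblPer n) κ) torRefl_torRefl)
      torRefl_torRefl (fun x y => lapF_torRefl κ c m2 x y) (fun w' => f (foldBox n w'))
    have heven : (fun y => f (foldBox n ((Function.Involutive.toPerm (torRefl (dblPer n) κ) torRefl_torRefl) y))) = fun w' => f (foldBox n w') := by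
      funext y
      show f (foldBox n (torRefl (dblPer n) κ y)) = f (foldBox n y)
      rw [foldBox_torRefl]
    rw [heven] at hθ
    have h := congr_fun hθ (torReflS (dblPer n) S w)
    rw [← ih w]
    exact h.symm

/-- ★ THE EVEN EXTENSION SATISFIES `(B F)(dblBox s) = ((c(−Δ_free)+m²)f)(s)` (the reflection principle of part Ν-a for `F = f∘foldBox`). [cite: King1986, §4 p.670] -/
theorem lapF_mulVec_evenExt_dblBox (c m2 : ℝ) (f : KingBox n → ℝ) (s : KingBox n) :
    (lapF (dblPer n) c m2 *ᵥ fun w' => f (foldBox n w')) (dblBox n s) = (boxOp n c m2 *ᵥ f) s := by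
  rw [lapF_mulVec_even_dblBox n c m2 (fun w' => f (foldBox n w')) (fun κ z => by simp only [foldBox_torRefl]) s]
  simp only [foldBox_dblBox]

end EvenExtension

/-! ## §2 The free-boundary quadratic form is `2^{−(d+1)}` × the torus form of the even extension -/

section Form

variable (n : Fin (d + 1) → ℕ) [hn : ∀ μ, NeZero (n μ)]

/-- ★★ **THE NEUMANN FORM BY DOUBLING**: `⟨F, B_{T(2n)}F⟩ = 2^{d+1}·⟨f, (c(−Δ_free)+m²)f⟩` for the even extension `F = f∘foldBox` — each of the `2^{d+1}`
reflected copies of the box carries one copy of the free-boundary form (the bonds across the faces join equal values and contribute nothing).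
[cite: King1986, §4 p.670, (2.13) p.653] -/
theorem dotProduct_lapF_evenExt (c m2 : ℝ) (f : KingBox n → ℝ) :
    (fun w => f (foldBox n w)) ⬝ᵥ (lapF (dblPer n) c m2 *ᵥ fun w => f (foldBox n w)) = 2 ^ (d + 1) * (f ⬝ᵥ (boxOp n c m2 *ᵥ f)) := by
  simp only [dotProduct]
  rw [sum_dblTorus_eq_sum_images]
  have hterm : ∀ (S : Finset (Fin (d + 1))) (s : KingBox n),
      f (foldBox n (torReflS (dblPer n) S (dblBox n s))) * (lapF (dblPer n) c m2 *ᵥ fun w => f (foldBox n w)) (torReflS (dblPer n) S (dblBox n s))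
        = f s * (boxOp n c m2 *ᵥ f) s := by
    intro S s
    rw [foldBox_torReflS_dblBox, lapF_mulVec_evenExt_torReflS, lapF_mulVec_evenExt_dblBox]
  simp_rw [hterm]
  rw [Finset.sum_const, Finset.card_univ, Fintype.card_finset, Fintype.card_fin, nsmul_eq_mul]
  push_cast; ring

/-- `⟨F, F⟩ = 2^{d+1}·⟨f, f⟩` for the even extension. [folklore] -/
theorem dotProduct_evenExt_self (f : KingBox n → ℝ) :
    (fun w => f (foldBox n w)) ⬝ᵥ (fun w => f (foldBox n w)) = 2 ^ (d + 1) * (f ⬝ᵥ f) := by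
  simp only [dotProduct]
  rw [sum_dblTorus_eq_sum_images]
  simp_rw [foldBox_torReflS_dblBox]
  rw [Finset.sum_const, Finset.card_univ, Fintype.card_finset, Fintype.card_fin, nsmul_eq_mul]
  push_cast; ring

/-- ★★ **THE FREE-BOUNDARY OPERATOR IS COERCIVE WITH THE TORUS FLOOR**: `⟨f, (c(−Δ_free)+m²)f⟩ ≥ m²⟨f,f⟩` (`c ≥ 0`; from `lapF_coercive` on the doubled torus
through the even extension). [cite: King1986, (2.13) p.653, §4 p.670] -/
theorem boxOp_coercive {c : ℝ} (hc : 0 ≤ c) (m2 : ℝ) : Coercive (boxOp n c m2) m2 := by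
  intro f
  have hco := lapF_coercive (dblPer n) c m2 hc (fun w => f (foldBox n w))
  rw [dotProduct_lapF_evenExt, dotProduct_evenExt_self] at hco
  have hpos : (0 : ℝ) < 2 ^ (d + 1) := by positivity
  nlinarith

/-- ★ **THE FREE-BOUNDARY OPERATOR IS SYMMETRIC** (`c ≥ 0`, `m² > 0`): its inverse `G^{Ω}` is symmetric (part Ν-a′) and `A = (A⁻¹)⁻¹`. [folklore] -/
theorem boxOp_transpose {c m2 : ℝ} (hc : 0 ≤ c) (hm : 0 < m2) : (boxOp n c m2)ᵀ = boxOp n c m2 := by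
  have hU : IsUnit (boxOp n c m2).det := (Matrix.isUnit_iff_isUnit_det _).mp (isUnit_boxOp n hc hm)
  have hinvT : ((boxOp n c m2)⁻¹)ᵀ = (boxOp n c m2)⁻¹ := by
    ext s t
    rw [Matrix.transpose_apply, boxOp_inv_eq_kingBoxGreen n hc hm, boxOp_inv_eq_kingBoxGreen n hc hm, kingBoxGreen_symm]
  calc (boxOp n c m2)ᵀ = ((boxOp n c m2)⁻¹⁻¹)ᵀ := by rw [Matrix.nonsing_inv_nonsing_inv _ hU]
    _ = (((boxOp n c m2)⁻¹)ᵀ)⁻¹ := by rw [Matrix.transpose_nonsing_inv]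
    _ = boxOp n c m2 := by rw [hinvT, Matrix.nonsing_inv_nonsing_inv _ hU]

/-- `boxOp t s = boxOp s t`. [folklore] -/
theorem boxOp_comm {c m2 : ℝ} (hc : 0 ≤ c) (hm : 0 < m2) (s t : KingBox n) : boxOp n c m2 t s = boxOp n c m2 s t := by
  rw [← Matrix.transpose_apply (boxOp n c m2) s t, boxOp_transpose n hc hm]

/-- ★★ **THE FREE-BOUNDARY OPERATOR IS POSITIVE DEFINITE** (`c ≥ 0`, `m² > 0`). [cite: King1986, (2.13) p.653, §4 p.670] -/
theorem boxOp_posDef {c m2 : ℝ} (hc : 0 ≤ c) (hm : 0 < m2) : (boxOp n c m2).PosDef := by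
  refine Matrix.PosDef.of_dotProduct_mulVec_pos ?_ fun x hx => ?_
  · show (boxOp n c m2)ᴴ = boxOp n c m2
    rw [Matrix.conjTranspose_eq_transpose_of_trivial, boxOp_transpose n hc hm]
  · rw [star_trivial]
    have hcoe := boxOp_coercive n hc m2 x
    have hxx0 : 0 ≤ x ⬝ᵥ x := Finset.sum_nonneg fun i _ => mul_self_nonneg _
    have hxx : x ⬝ᵥ x ≠ 0 := fun h0 => hx (dotProduct_self_eq_zero.mp h0)
    have hxxp : 0 < x ⬝ᵥ x := lt_of_le_of_ne hxx0 (Ne.symm hxx)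
    nlinarith [mul_pos hm hxxp]

end Form

/-! ## §3 King's free field on the box with free boundary conditions: the density-defined Gaussian law and its covariance -/

section Law

variable (n : Fin (d + 1) → ℕ) [hn : ∀ μ, NeZero (n μ)]

/-- The law `ρ_Ω(φ)dφ ∝ exp(−½⟨φ,(c(−Δ_free)+m²)φ⟩)dφ` on `ℝ^Ω` is a probability measure (`c ≥ 0`, `m² > 0`). [cite: King1986, (2.6) p.652, §4 p.670] -/
theorem isProbabilityMeasure_boxLaw {c m2 : ℝ} (hc : 0 ≤ c) (hm : 0 < m2) : IsProbabilityMeasure (gaussLaw (boxOp n c m2)) :=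
  isProbabilityMeasure_gaussLaw hm (boxOp_coercive n hc m2)

/-- ★★★ **THE TWO-POINT FUNCTION OF KING's FREE FIELD ON THE BOX WITH FREE BOUNDARY CONDITIONS IS THE IMAGE SUM**:
`Cov(φ(s), φ(t)) = Σ_{S ⊆ {0,…,d}} (c(−Δ)+m²)⁻¹_{T(2n)}(dblBox s, σ_S dblBox t)` under `ρ_Ω(φ)dφ` (`c ≥ 0`, `m² > 0`). [cite: King1986, (2.6) p.652, §4 p.670] -/
theorem cov_eval_boxLaw {c m2 : ℝ} (hc : 0 ≤ c) (hm : 0 < m2) (s t : KingBox n) :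
    cov[fun φ : KingBox n → ℝ => φ s, fun φ : KingBox n → ℝ => φ t; gaussLaw (boxOp n c m2)]
      = ∑ S : Finset (Fin (d + 1)), (lapF (dblPer n) c m2)⁻¹ (dblBox n s) (torReflS (dblPer n) S (dblBox n t)) := by
  rw [covariance_eval_gaussLaw hm (boxOp_coercive n hc m2) (boxOp_transpose n hc hm), boxOp_inv_apply n hc hm]

/-- The box law is the centred Gaussian field with covariance kernel `G^{Ω}`. [cite: King1986, (2.6) p.652, §4 p.670] -/
theorem boxLaw_eq_gaussianFieldOfKernel {c m2 : ℝ} (hc : 0 ≤ c) (hm : 0 < m2) :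
    gaussLaw (boxOp n c m2) = gaussianFieldOfKernel fun s t : KingBox n => kingBoxGreen n c m2 s t := by
  rw [gaussLaw_eq_gaussianFieldOfKernel hm (boxOp_coercive n hc m2) (boxOp_transpose n hc hm)]
  congr 1
  funext s t
  exact boxOp_inv_eq_kingBoxGreen n hc hm s t

/-- ★ The two-point function of the free-boundary field is STRICTLY POSITIVE and dominates the doubled-torus two-point function (`c > 0`).
[cite: King1986, §4 p.670] -/
theorem cov_eval_boxLaw_pos {c m2 : ℝ} (hc : 0 < c) (hm : 0 < m2) (s t : KingBox n) :
    0 < cov[fun φ : KingBox n → ℝ => φ s, fun φ : KingBox n → ℝ => φ t; gaussLaw (boxOp n c m2)] := by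
  rw [cov_eval_boxLaw n hc.le hm]
  exact kingBoxGreen_pos n hc hm s t

/-- ★ The timeslice two-point function of the free-boundary field: `Σ_{s′_κ = a} Cov(φ(s′), φ(t)) = c⁻¹·pathGreen (n κ) (m²∕c) a t_κ` — pure `cosh·cosh`
with King's torus mass (part Ν-b). [cite: King1986, §4 p.670; MontvayMunster1994, §2.2.1 (2.74)–(2.76)] -/
theorem timeSlice_cov_boxLaw {c m2 : ℝ} (hc : 0 < c) (hm : 0 < m2) (κ : Fin (d + 1)) (t : KingBox n) (a : Fin (n κ)) :
    ∑ s' : KingBox n, (if s' κ = a then cov[fun φ : KingBox n → ℝ => φ s', fun φ : KingBox n → ℝ => φ t; gaussLaw (boxOp n c m2)] else 0)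
      = c⁻¹ * pathGreen (n κ) (m2 / c) a (t κ) := by
  have h : ∀ s' : KingBox n, cov[fun φ : KingBox n → ℝ => φ s', fun φ : KingBox n → ℝ => φ t; gaussLaw (boxOp n c m2)] = kingBoxGreen n c m2 s' t :=
    fun s' => by rw [cov_eval_boxLaw n hc.le hm]; rfl
  simp_rw [h]
  exact timeSlice_kingBoxGreen_eq_pathGreen n κ hc hm t a

end Law

end Summit.QuantumFields.YangMills.BalabanUVNodes.N15KingModelRung.TorusSpectral
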